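import Mathlib
import Summits.Ventures.HodgeRepro.Tier4.Common.MixedPlaneKType
import Summits.Ventures.HodgeRepro.Tier4.Common.MixedPlaneCusp
import Summits.Ventures.HodgeRepro.Tier4.Common.LocalTorus
import Summits.Ventures.HodgeRepro.Tier4.Line1.RTFSetting

/-!
# Tier4/Common/KTypeSpace — the exact `K`-type space `V^τ` of an automorphic subspace and the admissibility clauses of
the L4 wall on an `RTF.Setting` (t4-plan-4's v0.16 local vocabulary, S13231, hosted in Common on its R2 request; the
text of the definitions is plan-4's, docstrings included)

Blind re-derivation cell `pub-hodge-repro`, Tier 4 (README §9–§10), seat t4-typer-2 (gen 2).  Target tree path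
`lean/Summits/Ventures/HodgeRepro/Tier4/Common/KTypeSpace.lean`.  Imports `MixedPlaneKType` (`localTorusAt`,
`localTorusAt'`, `weightAt`, `weightAt'`, `HasKTypeAt`, `HasKTypeAt'`), `MixedPlaneCusp` (`IsCuspidalSubspace`),
`LocalTorus` (`finitePart`, `IsCompactOpenIn`, `RightInvariantUnder` through AdelicPlaces), `Line1/RTFSetting`
(`RTF.Setting.IsInvariantSubspace`, `RTF.Setting.IsIrreducible`, t4-plan-1 p662473).

* **`kTypeSpace W q g g' eP eM eP' eM' K V`** — the vectors of `V` with the archimedean weights `(eP w, eM w)` under the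
  local torus of `T` and `(eP′ w, eM′ w)` under the local torus of the transported `T′` at EVERY infinite place `w`,
  fixed by the level `K` (a compact open subgroup of the finite part): a submodule of `V` (`kTypeSpace_le`);
* **`IsAdmissibleS S q g g' w₀ eP eM eP' eM' V`** — `V` is an invariant subspace in L1's sense
  (`RTF.Setting.IsInvariantSubspace`: left `G(k)`-invariant continuous functions, stable under right translation and
  under every `R(f)`), IRREDUCIBLE in the `L²(D_G)`-topological sense (`RTF.Setting.IsIrreducible`: every invariant
  subspace of `V` is zero or dense in `V` — the unitary notion read on continuous representatives, replacing the
  ALGEBRAIC `IsIrreducibleAutomorphic` of MixedPlaneKType, which no infinite-dimensional `V` satisfies: bus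
  S13201 / S13205 / S13213), cuspidal, with the two `K`-types at every real place, lowest at `w₀`;
* `isCompactOpenIn_iff_exists_isOpen` — the subspace-topology form of `IsCompactOpenIn` (LocalTorus v0.2) is the
  «trace of an open set of `G(𝔸)`» form plan-4 drafted.

Nothing here says anything about the status of the Hodge conjecture for CM abelian varieties, which is NOT proved
(HC_CM is NOT proved by anyone in this repository).
-/

set_option autoImplicit false

noncomputable section

namespace Summit.Ventures.HodgeRepro.Tier4.Common

open NumberField MeasureTheory

section KTypeSpace

variable {k : Type} [Field k] [NumberField k] (W : PlaneData k)

/-- **The `K`-type space `V^τ` of `V`** (the EXACT isotypic space — bus S13216 (3)): the vectors of `V` with the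
archimedean weights `(eP w, eM w)` under the local torus of `T` and `(eP′ w, eM′ w)` under the local torus of the
transported `T′` at EVERY infinite place `w`, and fixed by the level `K` (a compact open subgroup of the finite part).
The conditions are linear in `f`, so this is a submodule; for a genuine automorphic `V` it is finite-dimensional
(admissibility), DISPLAYED in the wall. -/
def kTypeSpace (q : QuadData k) (g g' : Matrix (Fin 4) (Fin 4) k) (eP eM eP' eM' : InfinitePlace k → ℤ)
    (K : Subgroup (GA W)) (V : Submodule ℂ (GA W → ℂ)) : Submodule ℂ (GA W → ℂ) where
  carrier := {f | f ∈ V ∧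
    (∀ (w : InfinitePlace k) (x κ : GA W), κ ∈ localTorusAt W w →
      f (x * κ) = weightAt W q w 0 κ ^ eP w * weightAt W q w 1 κ ^ eM w * f x) ∧
    (∀ (w : InfinitePlace k) (x κ : GA W), κ ∈ localTorusAt' W w →
      f (x * κ) = weightAt' W q w g g' 0 κ ^ eP' w * weightAt' W q w g g' 1 κ ^ eM' w * f x) ∧
    ∀ (x κ : GA W), κ ∈ K → f (x * κ) = f x}
  zero_mem' := ⟨V.zero_mem, fun _ _ _ _ => by simp, fun _ _ _ _ => by simp, fun _ _ _ => rfl⟩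
  add_mem' := by
    rintro f f' ⟨hf, hfT, hfT', hfK⟩ ⟨hf', hf'T, hf'T', hf'K⟩
    refine ⟨V.add_mem hf hf', fun w x κ hκ => ?_, fun w x κ hκ => ?_, fun x κ hκ => ?_⟩
    · simp only [Pi.add_apply, hfT w x κ hκ, hf'T w x κ hκ]
      ring
    · simp only [Pi.add_apply, hfT' w x κ hκ, hf'T' w x κ hκ]
      ring
    · simp only [Pi.add_apply, hfK x κ hκ, hf'K x κ hκ]
  smul_mem' := by
    rintro c f ⟨hf, hfT, hfT', hfK⟩
    refine ⟨V.smul_mem c hf, fun w x κ hκ => ?_, fun w x κ hκ => ?_, fun x κ hκ => ?_⟩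
    · simp only [Pi.smul_apply, smul_eq_mul, hfT w x κ hκ]
      ring
    · simp only [Pi.smul_apply, smul_eq_mul, hfT' w x κ hκ]
      ring
    · simp only [Pi.smul_apply, smul_eq_mul, hfK x κ hκ]

/-- `V^τ ≤ V`. -/
theorem kTypeSpace_le (q : QuadData k) (g g' : Matrix (Fin 4) (Fin 4) k) (eP eM eP' eM' : InfinitePlace k → ℤ)
    (K : Subgroup (GA W)) (V : Submodule ℂ (GA W → ℂ)) : kTypeSpace W q g g' eP eM eP' eM' K V ≤ V :=
  fun _ hf => hf.1

/-- The `K`-type space lies in the `K`-fixed vectors (LocalTorus `fixedBy`). -/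
theorem kTypeSpace_le_fixedBy (q : QuadData k) (g g' : Matrix (Fin 4) (Fin 4) k)
    (eP eM eP' eM' : InfinitePlace k → ℤ) (K : Subgroup (GA W)) (V : Submodule ℂ (GA W → ℂ)) :
    kTypeSpace W q g g' eP eM eP' eM' K V ≤ fixedBy W K V :=
  fun _ hf => ⟨hf.1, fun x κ hκ => hf.2.2.2 x κ hκ⟩

/-- **The admissibility clauses of the wall on the RTF SETTING**: `V` is an invariant subspace of the continuous
`G(k)`-invariant functions in L1's sense (`RTF.Setting.IsInvariantSubspace`: left-invariant, continuous, right-stable,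
stable under every `R(f)`), IRREDUCIBLE in the `L²(D_G)`-TOPOLOGICAL sense (`RTF.Setting.IsIrreducible`: every
invariant subspace of `V` is zero or `L²(D_G)`-dense in `V` — the unitary notion read on continuous representatives,
replacing the ALGEBRAIC `IsIrreducibleAutomorphic`, which no infinite-dimensional `V` satisfies: bus S13201/S13205),
cuspidal, with the two `K`-types at every real place, lowest at `w₀`. -/
def IsAdmissibleS [MeasurableSpace (GA W)] [BorelSpace (GA W)] (S : Line1.RTF.Setting (GA W)) (q : QuadData k)
    (g g' : Matrix (Fin 4) (Fin 4) k)
    (w₀ : InfinitePlace k) (eP eM eP' eM' : InfinitePlace k → ℤ) (V : Submodule ℂ (GA W → ℂ)) : Prop :=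
  S.IsInvariantSubspace (V : Set (GA W → ℂ)) ∧
  S.IsIrreducible (V : Set (GA W → ℂ)) ∧
  IsCuspidalSubspace W V ∧
  (∀ w, HasKTypeAt W q w (eP w) (eM w) V) ∧
  (∀ j : ℤ, |(eP w₀ - eM w₀) + 2 * j| < 3 → ¬ HasKTypeAt W q w₀ (eP w₀ + j) (eM w₀ - j) V) ∧
  (∀ w, HasKTypeAt' W q w g g' (eP' w) (eM' w) V) ∧
  (∀ j : ℤ, |(eP' w₀ - eM' w₀) + 2 * j| < 3 → ¬ HasKTypeAt' W q w₀ g g' (eP' w₀ + j) (eM' w₀ - j) V)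

/-- **The two forms of «compact open in `S`» agree**: open in the subspace topology of `S` ⟺ the trace on `S` of an open
set of `G(𝔸)` (given `K ≤ S`). -/
theorem isCompactOpenIn_iff_exists_isOpen (S K : Subgroup (GA W)) :
    IsCompactOpenIn W S K ↔
      K ≤ S ∧ IsCompact (K : Set (GA W)) ∧ ∃ O : Set (GA W), IsOpen O ∧ O ∩ (S : Set (GA W)) = (K : Set (GA W)) := by
  constructor
  · rintro ⟨hle, hc, ho⟩
    refine ⟨hle, hc, ?_⟩
    obtain ⟨O, hO, hOK⟩ := isOpen_induced_iff.1 ho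
    refine ⟨O, hO, ?_⟩
    ext x
    constructor
    · rintro ⟨hxO, hxS⟩
      exact (Set.ext_iff.1 hOK ⟨x, hxS⟩).1 hxO
    · intro hxK
      exact ⟨(Set.ext_iff.1 hOK ⟨x, hle hxK⟩).2 hxK, hle hxK⟩
  · rintro ⟨hle, hc, O, hO, hOK⟩
    refine ⟨hle, hc, ?_⟩
    rw [isOpen_induced_iff]
    refine ⟨O, hO, ?_⟩
    ext ⟨x, hxS⟩
    change x ∈ O ↔ x ∈ (K : Set (GA W))
    rw [← hOK]
    exact ⟨fun h => ⟨h, hxS⟩, fun h => h.1⟩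


/-! ## v0.2 (t4-typer-2 g3, append-only): the `T′`-TYPE SPACE `V^{τ′,K}` — the REPAIR OF O-L4-JOINT

O-L4-JOINT (t4-L4-p2 S13737, t4-L4-p1 S13756, crit-1 S13773, crit-2 S13774, plan-4 S13808; kernel half
`Line4.KTypeJoint`): the JOINT clauses of `kTypeSpace` — weights under `T_w` AND under the transported `T′_w` at the
same place — force `kTypeSpace … K V = ⊥` on every datum with `T′_{w₀} ≠ T_{w₀}` (two distinct maximal compact tori
of `U(1,1)` generate a group containing the perfect `SU(1,1)`).  The planner's call (plan-4 S13808): the Riesz space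
carries the `T′`-clauses and `K` ONLY.  `kTypeSpace'` below is `kTypeSpace` with the `localTorusAt` clause DELETED,
same `Submodule` packaging; `kTypeSpace ≤ kTypeSpace'`, `kTypeSpace' ≤ V`, `kTypeSpace' ≤ fixedBy`, monotone in `V`,
and the battery value `kTypeSpace' … K ⊥ = ⊥`.  The `T`-twin (weights under `localTorusAt`, no `T′`-clause) is the
same text with the unprimed objects — not declared here (one object of record; on request). -/

/-- **The `T′`-type space `V^{τ′,K}` of `V`** (the repair of O-L4-JOINT, plan-4 S13808): the vectors of `V` with the
archimedean weights `(eP′ w, eM′ w)` under the local torus of the transported `T′` at EVERY infinite place `w`, and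
fixed by the level `K` — `kTypeSpace` WITHOUT the `T`-clause.  A submodule of `V`. -/
def kTypeSpace' (q : QuadData k) (g g' : Matrix (Fin 4) (Fin 4) k) (eP' eM' : InfinitePlace k → ℤ)
    (K : Subgroup (GA W)) (V : Submodule ℂ (GA W → ℂ)) : Submodule ℂ (GA W → ℂ) where
  carrier := {f | f ∈ V ∧
    (∀ (w : InfinitePlace k) (x κ : GA W), κ ∈ localTorusAt' W w →
      f (x * κ) = weightAt' W q w g g' 0 κ ^ eP' w * weightAt' W q w g g' 1 κ ^ eM' w * f x) ∧
    ∀ (x κ : GA W), κ ∈ K → f (x * κ) = f x}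
  zero_mem' := ⟨V.zero_mem, fun _ _ _ _ => by simp, fun _ _ _ => rfl⟩
  add_mem' := by
    rintro f f' ⟨hf, hfT', hfK⟩ ⟨hf', hf'T', hf'K⟩
    refine ⟨V.add_mem hf hf', fun w x κ hκ => ?_, fun x κ hκ => ?_⟩
    · simp only [Pi.add_apply, hfT' w x κ hκ, hf'T' w x κ hκ]
      ring
    · simp only [Pi.add_apply, hfK x κ hκ, hf'K x κ hκ]
  smul_mem' := by
    rintro c f ⟨hf, hfT', hfK⟩
    refine ⟨V.smul_mem c hf, fun w x κ hκ => ?_, fun x κ hκ => ?_⟩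
    · simp only [Pi.smul_apply, smul_eq_mul, hfT' w x κ hκ]
      ring
    · simp only [Pi.smul_apply, smul_eq_mul, hfK x κ hκ]

/-- Membership in `V^{τ′,K}` unfolded. -/
theorem mem_kTypeSpace' (q : QuadData k) (g g' : Matrix (Fin 4) (Fin 4) k) (eP' eM' : InfinitePlace k → ℤ)
    (K : Subgroup (GA W)) (V : Submodule ℂ (GA W → ℂ)) (f : GA W → ℂ) :
    f ∈ kTypeSpace' W q g g' eP' eM' K V ↔ f ∈ V ∧
      (∀ (w : InfinitePlace k) (x κ : GA W), κ ∈ localTorusAt' W w →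
        f (x * κ) = weightAt' W q w g g' 0 κ ^ eP' w * weightAt' W q w g g' 1 κ ^ eM' w * f x) ∧
      ∀ (x κ : GA W), κ ∈ K → f (x * κ) = f x :=
  Iff.rfl

/-- `V^{τ′,K} ≤ V`. -/
theorem kTypeSpace'_le (q : QuadData k) (g g' : Matrix (Fin 4) (Fin 4) k) (eP' eM' : InfinitePlace k → ℤ)
    (K : Subgroup (GA W)) (V : Submodule ℂ (GA W → ℂ)) : kTypeSpace' W q g g' eP' eM' K V ≤ V :=
  fun _ hf => hf.1

/-- `V^{τ′,K}` lies in the `K`-fixed vectors. -/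
theorem kTypeSpace'_le_fixedBy (q : QuadData k) (g g' : Matrix (Fin 4) (Fin 4) k) (eP' eM' : InfinitePlace k → ℤ)
    (K : Subgroup (GA W)) (V : Submodule ℂ (GA W → ℂ)) : kTypeSpace' W q g g' eP' eM' K V ≤ fixedBy W K V :=
  fun _ hf => ⟨hf.1, fun x κ hκ => hf.2.2 x κ hκ⟩

/-- The joint space lies in the `T′`-type space (dropping the `T`-clause only enlarges). -/
theorem kTypeSpace_le_kTypeSpace' (q : QuadData k) (g g' : Matrix (Fin 4) (Fin 4) k)
    (eP eM eP' eM' : InfinitePlace k → ℤ) (K : Subgroup (GA W)) (V : Submodule ℂ (GA W → ℂ)) :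
    kTypeSpace W q g g' eP eM eP' eM' K V ≤ kTypeSpace' W q g g' eP' eM' K V :=
  fun _ hf => ⟨hf.1, hf.2.2.1, hf.2.2.2⟩

/-- `V^{τ′,K}` is monotone in `V`. -/
theorem kTypeSpace'_mono (q : QuadData k) (g g' : Matrix (Fin 4) (Fin 4) k) (eP' eM' : InfinitePlace k → ℤ)
    (K : Subgroup (GA W)) {V V' : Submodule ℂ (GA W → ℂ)} (h : V ≤ V') :
    kTypeSpace' W q g g' eP' eM' K V ≤ kTypeSpace' W q g g' eP' eM' K V' :=
  fun _ hf => ⟨h hf.1, hf.2.1, hf.2.2⟩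

/-- The battery value: the `T′`-type space of the zero subspace is zero. -/
theorem kTypeSpace'_bot (q : QuadData k) (g g' : Matrix (Fin 4) (Fin 4) k) (eP' eM' : InfinitePlace k → ℤ)
    (K : Subgroup (GA W)) : kTypeSpace' W q g g' eP' eM' K ⊥ = ⊥ :=
  le_bot_iff.1 (kTypeSpace'_le W q g g' eP' eM' K ⊥)

/-- A vector of `V^{τ′,K}` is right-equivariant under `localTorusAt' W w` with the character
`κ ↦ weightAt' … 0 κ ^ eP′ w * weightAt' … 1 κ ^ eM′ w` — the shape `kProj_of_equivariant` (KTypeProjector) consumes. -/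
theorem apply_mul_of_mem_kTypeSpace' (q : QuadData k) (g g' : Matrix (Fin 4) (Fin 4) k)
    (eP' eM' : InfinitePlace k → ℤ) (K : Subgroup (GA W)) (V : Submodule ℂ (GA W → ℂ)) {f : GA W → ℂ}
    (hf : f ∈ kTypeSpace' W q g g' eP' eM' K V) (w : InfinitePlace k) (x : GA W) {κ : GA W}
    (hκ : κ ∈ localTorusAt' W w) :
    f (x * κ) = weightAt' W q w g g' 0 κ ^ eP' w * weightAt' W q w g g' 1 κ ^ eM' w * f x :=
  hf.2.1 w x κ hκ

end KTypeSpace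

end Summit.Ventures.HodgeRepro.Tier4.Common

end
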